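import Literature.Topology.FourManifolds.GaussDiagramsReadUnique
import Literature.Topology.FourManifolds.LeeRasmussenProofs
import Literature.Topology.FourManifolds.KhFrobeniusRMove
import HarnessLib

/-!
# Khovanov homology, Lee homology and Rasmussen's `s` do not depend on the regular projection of a knot

Consequences of reading uniqueness (`Knot.RegularProjection.isRelabelling_diagram`,
`GaussDiagramsReadUnique.lean`: two regular projections of ONE knot read relabelled Gauss diagrams)
and of the invariance of the cube complex under relabelling (Khovanov (2000), §3.3, §4.2; in the tree
`nonempty_iso_khovanovHomology_of_isRelabelling`, `nonempty_iso_frobeniusHomology_of_isRelabelling`,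
`rasmussenInvariant_eq_of_isRelabelling`): **for a fixed knot `K`, every regular projection of `K`
reads the same Rasmussen invariant, the same Khovanov homology and the same homology over every
Frobenius system** — unconditionally (no Reidemeister theorem is involved: the knot is not moved).
What remains conditional on Reidemeister's theorem (`Knot.reidemeisterR`, `RasmussenWellDefinedR.lean`)
is only the passage to an ISOTOPIC knot `K'`, i.e. the knot-level predicate
`Knot.HasRasmussenInvariant`, which quantifies over isotopic representatives.

* `Knot.RegularProjection.rasmussenInvariant_diagram_eq` — `s(P₁.diagram) = s(P₂.diagram)`;
* `Knot.HasGaussDiagram.rasmussenInvariant_eq` — two Gauss diagrams of one knot have the same `s`;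
* `Knot.RegularProjection.nonempty_iso_khovanovHomology_diagram`,
  `Knot.RegularProjection.nonempty_iso_frobeniusHomology_diagram` — and isomorphic homologies.

Everything is proved; no definition and no named fact is introduced.

## References

* M. Khovanov, *A categorification of the Jones polynomial*, Duke Math. J. 101 (2000), §3.3, §4.2.
  [cite: Khovanov2000, §3.3]
* J. Rasmussen, *Khovanov homology and the slice genus*, Invent. Math. 182 (2010), Def. 3.4
  (`s` is read on any diagram). [cite: Rasmussen2010, Def. 3.4]
* M. Goussarov, M. Polyak, O. Viro, Topology 39 (2000), §1.2. [cite: GPV2000, §1.2]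
-/

open CategoryTheory

noncomputable section

namespace Literature.Topology.FourManifolds

namespace Knot.RegularProjection

variable {K : Knot} (P₁ P₂ : K.RegularProjection)

/-- **Rasmussen's `s` read on a knot does not depend on the regular projection**: two regular
projections of one knot read Gauss diagrams with the same Rasmussen invariant (they are relabellings
of each other, and `s` is invariant under relabelling). Rasmussen (2010), Def. 3.4; Khovanov (2000),
§3.3. [cite: Rasmussen2010, Def. 3.4] -/
theorem rasmussenInvariant_diagram_eq :
    P₁.diagram.rasmussenInvariant = P₂.diagram.rasmussenInvariant :=
  (GaussDiagram.rasmussenInvariant_eq_of_isRelabelling (P₁.isRelabelling_diagram P₂)).symm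

/-- **Khovanov homology read on a knot does not depend on the regular projection.**
Khovanov (2000), §3.3, §4.2. [cite: Khovanov2000, §3.3] -/
theorem nonempty_iso_khovanovHomology_diagram (i j : ℤ) :
    Nonempty (P₁.diagram.khovanovHomology i j ≅ P₂.diagram.khovanovHomology i j) :=
  GaussDiagram.nonempty_iso_khovanovHomology_of_isRelabelling (P₁.isRelabelling_diagram P₂) i j

/-- **The homology over the universal Frobenius system (in particular Lee homology) read on a knot
does not depend on the regular projection.** Khovanov (2000), §3.3; Khovanov (2006), Prop. 6.
[cite: Khovanov2000, §3.3] -/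
theorem nonempty_iso_frobeniusHomology_diagram {R : Type} [CommRing R] (hR tR : R) (i : ℤ) :
    Nonempty (P₁.diagram.frobeniusHomology R hR tR i ≅ P₂.diagram.frobeniusHomology R hR tR i) :=
  GaussDiagram.nonempty_iso_frobeniusHomology_of_isRelabelling hR tR (P₁.isRelabelling_diagram P₂) i

end Knot.RegularProjection

/-- **Two Gauss diagrams of one knot have the same Rasmussen invariant.** [cite: Rasmussen2010, Def. 3.4] -/
theorem Knot.HasGaussDiagram.rasmussenInvariant_eq {K : Knot} {G G' : GaussDiagram}
    (h : K.HasGaussDiagram G) (h' : K.HasGaussDiagram G') :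
    G.rasmussenInvariant = G'.rasmussenInvariant := by
  obtain ⟨P, rfl⟩ := h
  obtain ⟨P', rfl⟩ := h'
  exact P.rasmussenInvariant_diagram_eq P'

/-- **Two Gauss diagrams of one knot have isomorphic Khovanov homology.** [cite: Khovanov2000, §3.3] -/
theorem Knot.HasGaussDiagram.nonempty_iso_khovanovHomology {K : Knot} {G G' : GaussDiagram}
    (h : K.HasGaussDiagram G) (h' : K.HasGaussDiagram G') (i j : ℤ) :
    Nonempty (G.khovanovHomology i j ≅ G'.khovanovHomology i j) := by
  obtain ⟨P, rfl⟩ := h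
  obtain ⟨P', rfl⟩ := h'
  exact P.nonempty_iso_khovanovHomology_diagram P' i j

/-- Hence the knot-level Rasmussen invariant of a knot that HAS a regular projection is the invariant
of that projection, as soon as the representative can be taken to be the knot itself: if
`K.HasRasmussenInvariant s` is witnessed by `K` itself (some projection of `K`), then every projection
of `K` reads `s`. [cite: Rasmussen2010, Def. 3.4] -/
theorem Knot.RegularProjection.rasmussenInvariant_eq_of_hasGaussDiagram {K : Knot}
    (P : K.RegularProjection) {G : GaussDiagram} (h : K.HasGaussDiagram G) :
    P.diagram.rasmussenInvariant = G.rasmussenInvariant :=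
  Knot.HasGaussDiagram.rasmussenInvariant_eq ⟨P, rfl⟩ h

end Literature.Topology.FourManifolds
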